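/-
Copyright: statement-level skeleton of a published paper (lit-balaban cell, Phase-2 proof seat p19, gen 7). No claims beyond
what the kernel checks below.
-/
import Mathlib
import Literature.MathematicalPhysics.QuantumFieldTheory.Balaban1983to89.B3Prop21Instance

/-!
# B3 — T. Bałaban, *(Higgs)₂,₃ quantum fields in a finite volume. III. Renormalization*, CMP **88** (1983) 411–445
[Balaban1983Higgs3] — p. 438 [PDF 28], the primitively divergent self-energy graphs (3.18) and the sentence of (3.19)/(3.20):
the BLOCK AND DEGREE CALCULUS of Sect. 2 ((2.2) p. 423, the subgraphs `G_i` / quotients `G/G_i` of (2.16) p. 428) IN CLOSED FORM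
for the graphs with ONE or TWO vertices — every picture of (3.18) (and (2.4), (3.6), (3.21)) is of this kind — along EVERY
ordering l̃ of the lines, and the resulting CRITERION for *"primitively divergent graphs (graphs whose every proper subgraph is
convergent)"* (p. 435) of *"degrees equal to 0"* (p. 438)

statement-level skeleton of published theorems with citation tags; proofs where landed; nothing here is a claim about
the Yang–Mills mass gap

PDF held: `paper:balaban1983-higgs-2-3-quantum-fields-finite-volume` (journal page = PDF page + 410); pp. 423–425, 428, 435, 438
[PDF 13–15, 18, 25, 28] read in the OCR text (`p0025.txt`, `p0028.txt`) and on the ×2 render `…/1983-cmp88-higgs23-III-p028-x2.png`.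

CITATION HEADER (lean-in-tree rule).  Part of the lit-balaban TYPED SKELETON (HOME `run/shared/lean/pub/lit-balaban/`), PHASE 2,
seat p19 generation 7 (file 1 of 2; file 2 `B3Eq318Members` instantiates it for the pictures of (3.18)).  WHAT IS REPRODUCED: rows
**B3.Eq3.18-3.20** (the (3.19)/(3.20) sentence for the WHOLE LIST (3.18)), **B3.Prop2.2** (how these generalized graphs meet its
hypothesis) and **B3.Eq2.2-2.3** / **B3.Def@420** (the degrees of the connected subgraphs along the orderings, computed) of
`HOME/lit-balaban-r15/ROWS-B3.md` (fold owner r15, referee ref-4).  CONSUMES BY NAME, nothing re-proved: this seat's count-data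
calculus `B3Ineq215.Counts`/`Model` (gen 2: `rep`, `rho`, `bs`, `bt`, `reps`, `fiber`, `before`, `Nontriv`; `B3Ineq215Quotient`),
`B3Ineq213.degQ`/`lineDimQ`/`relabelCounts`/`LinesConnect` (gens 3–4: `B3Prop21Instance`, `B3Prop21Model`, `B3Ineq213TreeLength`).
The conclusions are LITERALLY the two hypotheses `hprop`/`hzero` (resp. `hwhole`) of seat p18 gen 8's
`B3Eq320PositiveSubgraphs.posSubgraphsExcept24_of_degZero` / `posSubgraphsExcept24_of_properPos` (the (3.20) sentence proved
abstractly for gen 7's family `famK`), so that a picture is discharged by three numerical facts about its count datum.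

THE PRINTED TEXT (verbatim).  p. 435: *"The method described below, and even a simplified one, will be applied to all other
primitively divergent graphs (graphs whose every proper subgraph is convergent)."*  p. 438: *"Let us consider the other cases of
self-energy graphs for scalar fields. All the remaining divergent graphs of this type have degrees equal to 0. Primitively divergent
graphs, i.e. the graphs [(3.18): seven pictures, each with one or two vertices] are treated in a simpler way. … We get a generalized
expression of degree +α represented by some generalized graph whose every subgraph has a positive degree also."*  p. 428, (2.16):
*"G/G_i denotes a quotient graph, i.e. the graph G with all subgraphs G_i^{(α)} shrunk to points."*  p. 423, (2.2): *"D(G) =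
Σ_{v∈G} D_G(v) − d."*

WHAT IS PROVED, and how.  For a count datum `G` on the vertex set `Fin 2` (vertices `x = 0`, `x′ = 1`) each of whose lines is
EITHER a line joining `x` to `x′` (oriented `0 → 1`, hypothesis `horient`) OR a loop (a tadpole, `src = tgt`), and for every
ordering (the datum itself; orderings enter through `relabelCounts G σ`, which is again of this kind, `orient_relabelCounts`):
§1 `rep_eq_zero_of_conn` / `rep_eq_self_of_not_conn` — the block map of `G_i` is CONSTANT `x` as soon as one of the first `i`
lines joins `x` to `x′`, and the IDENTITY before (loops shrink nothing: *"the case v = v′"* p. 428); hence the vertices of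
`G/G_i` (`reps_of_conn`/`reps_of_not_conn`), the blocks (`fiber_…`), their line sets (`before_…`: the first `i` lines, resp. the
loops at the vertex among them) and **the degrees (2.2) in closed form**: `degQ_of_conn` (`D = d + e_x + e_{x′} + Σ_{l<i} a_l`)
and `degQ_of_not_conn` (`D = e_v + Σ_{loops l<i at v} a_l`).  §2 along an ordering `σ`: `lineDimQ_relabelCounts`, the WHOLE
graph — a block containing all the lines — has degree `W := d + e_x + e_{x′} + Σ_l a_l` whatever the ordering
(`degQ_relabel_of_before_eq_univ`), and **the criterion** `properPos_of_twoVertex`: if every line dimension is negative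
(`a_l < 0`: the case of all lines of the paper without averaged vector legs), `0 ≤ W`, and at each vertex carrying loops
`0 < e_v + Σ_{loops at v} a_l`, then EVERY PROPER connected subgraph along EVERY ordering has positive degree — because a proper
block reached after joining `x` to `x′` misses a nonempty set `S` of lines and has degree `W − Σ_{l∈S} a_l > 0`, while a block
`{v}` made of loops has degree `≥ e_v + Σ_{all loops at v} a_l`; `degZero_of_twoVertex` (`W = 0` ⇒ every whole block has degree
`0`: p. 438 *"degrees equal to 0"*) and `wholePos_of_twoVertex`.  §3 the same for ONE vertex (`Fin 1`; all lines loops — the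
second picture of (3.18)): `degQ_oneVertex`, `properPos_of_oneVertex`, `degZero_of_oneVertex`.  §4 connectivity:
`linesConnect_twoVertex`, `linesConnect_oneVertex`.
HONEST SCOPE: pure combinatorics of this seat's `Counts`/`Model` (no amplitude, no analytic input); "subgraph" = non-trivial block
along an ordering (the tree's reading of r15's `Sub`, gen 3); graphs with three or more vertices (the triangles (2.18)–(2.20),
(3.25), (3.33)) are NOT covered.  D-0026: theorems only (no definitions, no named facts, no `sorry`); standard axioms.  Unit
`lit-balaban-p19-g7` (literature-prover-lit-balaban-p19-g7-0), HOME `run/shared/lean/pub/lit-balaban/`, 2026-08-21.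
-/

open Finset

namespace Literature.MathematicalPhysics.QuantumFieldTheory.Balaban1983to89.B3TwoVertexBlocks

open B3Ineq215 B3Ineq213

/-! ## §1 Two vertices: the block map of `G_i` in closed form -/

section TwoVertex

variable {m : ℕ} (G : Counts (Fin 2) m)

/-- kernel: an element of `Fin 2` other than `0` is `1`. [folklore] -/
private theorem fin_two_eq_one_of_ne_zero {v : Fin 2} (h : v ≠ 0) : v = 1 := by
  fin_cases v
  · exact absurd rfl h
  · rfl

/-- The block map along the ordering, both cases at once (induction on the level `i`, (2.16) p. 428: shrinking the line
`l(i+1)` merges the block of its second endpoint into the block of its first; a loop — *"the case v = v′"* — merges nothing).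
[cite: Balaban1983Higgs3, (2.16) p.428] -/
theorem rep_eq_aux (horient : ∀ l, G.src l ≠ G.tgt l → G.src l = 0) :
    ∀ i : ℕ, ((∃ l : Fin m, (l : ℕ) < i ∧ G.src l ≠ G.tgt l) → ∀ v, G.toModel.rep i v = 0) ∧
      ((¬ ∃ l : Fin m, (l : ℕ) < i ∧ G.src l ≠ G.tgt l) → ∀ v, G.toModel.rep i v = v)
  | 0 => ⟨fun ⟨l, hl, _⟩ => absurd hl (Nat.not_lt_zero _), fun _ v => rfl⟩
  | i + 1 => by
      obtain ⟨ih1, ih2⟩ := rep_eq_aux horient i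
      by_cases h : i < m
      · by_cases hC : ∃ l : Fin m, (l : ℕ) < i ∧ G.src l ≠ G.tgt l
        · -- already merged: everything is the block `0`, and stays so
          have hC' : ∃ l : Fin m, (l : ℕ) < i + 1 ∧ G.src l ≠ G.tgt l := by
            obtain ⟨l, hl, hne⟩ := hC; exact ⟨l, Nat.lt_succ_of_lt hl, hne⟩
          refine ⟨fun _ v => ?_, fun hn => absurd hC' hn⟩
          rw [G.toModel.rep_succ h v, ih1 hC v]
          unfold Model.rho Model.bs Model.bt
          rw [ih1 hC, ih1 hC]
          simp
        · by_cases hl : G.src ⟨i, h⟩ = G.tgt ⟨i, h⟩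
          · -- the new line is a loop: nothing changes
            have hC' : ¬ ∃ l : Fin m, (l : ℕ) < i + 1 ∧ G.src l ≠ G.tgt l := by
              rintro ⟨l, hl1, hne⟩
              rcases Nat.lt_succ_iff_lt_or_eq.1 hl1 with hlt | heq
              · exact hC ⟨l, hlt, hne⟩
              · have : l = ⟨i, h⟩ := Fin.ext heq
                subst this
                exact hne hl
            refine ⟨fun hc => absurd hc hC', fun _ v => ?_⟩
            have heq : G.toModel.bs i h = G.toModel.bt i h := by
              unfold Model.bs Model.bt
              rw [ih2 hC, ih2 hC]
              exact hl
            rw [G.toModel.rep_succ_of_loop h heq v, ih2 hC v]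
          · -- the new line joins `x` to `x′`: both vertices are sent to `0`
            have hC' : ∃ l : Fin m, (l : ℕ) < i + 1 ∧ G.src l ≠ G.tgt l := ⟨⟨i, h⟩, Nat.lt_succ_self i, hl⟩
            have hs : G.src ⟨i, h⟩ = 0 := horient _ hl
            have ht : G.tgt ⟨i, h⟩ = 1 := fin_two_eq_one_of_ne_zero (fun h0 => hl (hs.trans h0.symm))
            refine ⟨fun _ v => ?_, fun hn => absurd hC' hn⟩
            rw [G.toModel.rep_succ h v, ih2 hC v]
            unfold Model.rho Model.bs Model.bt
            rw [ih2 hC, ih2 hC]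
            change (if v = G.tgt ⟨i, h⟩ then G.src ⟨i, h⟩ else v) = 0
            rw [hs, ht]
            fin_cases v <;> simp
      · -- no line `l(i+1)`: nothing changes
        have hiff : (∃ l : Fin m, (l : ℕ) < i + 1 ∧ G.src l ≠ G.tgt l) ↔ ∃ l : Fin m, (l : ℕ) < i ∧ G.src l ≠ G.tgt l := by
          constructor
          · rintro ⟨l, _, hne⟩; exact ⟨l, lt_of_lt_of_le l.isLt (not_lt.1 h), hne⟩
          · rintro ⟨l, hl, hne⟩; exact ⟨l, Nat.lt_succ_of_lt hl, hne⟩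
        refine ⟨fun hc v => ?_, fun hn v => ?_⟩
        · rw [G.toModel.rep_succ_of_not_lt h v]; exact ih1 (hiff.1 hc) v
        · rw [G.toModel.rep_succ_of_not_lt h v]; exact ih2 (fun hc => hn (hiff.2 hc)) v

/-- **Once one of the first `i` lines joins `x` to `x′`, `G_i` has ONE block, represented by `x = 0`** (both vertices are in the
connected component of that line; later lines and loops do not split it). [cite: Balaban1983Higgs3, (2.16) p.428] -/
theorem rep_eq_zero_of_conn (horient : ∀ l, G.src l ≠ G.tgt l → G.src l = 0) {i : ℕ}
    (hC : ∃ l : Fin m, (l : ℕ) < i ∧ G.src l ≠ G.tgt l) (v : Fin 2) : G.toModel.rep i v = 0 :=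
  (rep_eq_aux G horient i).1 hC v

/-- **While the first `i` lines are all loops, `G_i` has shrunk nothing**: every vertex is its own block (*"the case v = v′"*,
p. 428). [cite: Balaban1983Higgs3, (2.16) p.428] -/
theorem rep_eq_self_of_not_conn (horient : ∀ l, G.src l ≠ G.tgt l → G.src l = 0) {i : ℕ}
    (hC : ¬ ∃ l : Fin m, (l : ℕ) < i ∧ G.src l ≠ G.tgt l) (v : Fin 2) : G.toModel.rep i v = v :=
  (rep_eq_aux G horient i).2 hC v

/-- The vertices of `G/G_i` once `x` and `x′` are joined: the single vertex `x = 0`. [cite: Balaban1983Higgs3, (2.16) p.428] -/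
theorem reps_of_conn (horient : ∀ l, G.src l ≠ G.tgt l → G.src l = 0) {i : ℕ}
    (hC : ∃ l : Fin m, (l : ℕ) < i ∧ G.src l ≠ G.tgt l) : G.toModel.reps i = {0} := by
  ext b
  rw [G.toModel.mem_reps, rep_eq_zero_of_conn G horient hC, mem_singleton, eq_comm]

/-- The vertices of `G/G_i` before that: both vertices. [cite: Balaban1983Higgs3, (2.16) p.428] -/
theorem reps_of_not_conn (horient : ∀ l, G.src l ≠ G.tgt l → G.src l = 0) {i : ℕ}
    (hC : ¬ ∃ l : Fin m, (l : ℕ) < i ∧ G.src l ≠ G.tgt l) : G.toModel.reps i = univ := by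
  ext b
  simp only [G.toModel.mem_reps, rep_eq_self_of_not_conn G horient hC, mem_univ]

/-- A representative of a block of `G_i`, once `x` and `x′` are joined, is `x = 0`. [cite: Balaban1983Higgs3, (2.16) p.428] -/
theorem eq_zero_of_mem_reps_of_conn (horient : ∀ l, G.src l ≠ G.tgt l → G.src l = 0) {i : ℕ}
    (hC : ∃ l : Fin m, (l : ℕ) < i ∧ G.src l ≠ G.tgt l) {b : Fin 2} (hb : b ∈ G.toModel.reps i) : b = 0 := by
  rw [reps_of_conn G horient hC, mem_singleton] at hb; exact hb

/-- The block of `G_i` once `x` and `x′` are joined: both vertices. [cite: Balaban1983Higgs3, (2.16) p.428] -/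
theorem fiber_of_conn (horient : ∀ l, G.src l ≠ G.tgt l → G.src l = 0) {i : ℕ}
    (hC : ∃ l : Fin m, (l : ℕ) < i ∧ G.src l ≠ G.tgt l) : G.toModel.fiber i 0 = univ := by
  ext v
  simp only [G.toModel.mem_fiber, rep_eq_zero_of_conn G horient hC, mem_univ]

/-- The blocks of `G_i` before that: singletons. [cite: Balaban1983Higgs3, (2.16) p.428] -/
theorem fiber_of_not_conn (horient : ∀ l, G.src l ≠ G.tgt l → G.src l = 0) {i : ℕ}
    (hC : ¬ ∃ l : Fin m, (l : ℕ) < i ∧ G.src l ≠ G.tgt l) (b : Fin 2) : G.toModel.fiber i b = {b} := by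
  ext v
  rw [G.toModel.mem_fiber, rep_eq_self_of_not_conn G horient hC, mem_singleton]

/-- The lines of the block of `G_i` once `x` and `x′` are joined: ALL the first `i` lines of the ordering.
[cite: Balaban1983Higgs3, (2.16) p.428] -/
theorem before_of_conn (horient : ∀ l, G.src l ≠ G.tgt l → G.src l = 0) {i : ℕ}
    (hC : ∃ l : Fin m, (l : ℕ) < i ∧ G.src l ≠ G.tgt l) :
    G.toModel.before i 0 = univ.filter fun l : Fin m => (l : ℕ) < i := by
  ext l
  simp only [G.toModel.mem_before, mem_filter, mem_univ, true_and]
  change (l : ℕ) < i ∧ G.toModel.rep i (G.src l) = 0 ↔ _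
  rw [rep_eq_zero_of_conn G horient hC]
  simp

/-- The lines of the block `{v}` of `G_i` before that: the loops at `v` among the first `i` lines.
[cite: Balaban1983Higgs3, (2.16) p.428] -/
theorem before_of_not_conn (horient : ∀ l, G.src l ≠ G.tgt l → G.src l = 0) {i : ℕ}
    (hC : ¬ ∃ l : Fin m, (l : ℕ) < i ∧ G.src l ≠ G.tgt l) (b : Fin 2) :
    G.toModel.before i b = univ.filter fun l : Fin m => (l : ℕ) < i ∧ G.src l = b := by
  ext l
  simp only [G.toModel.mem_before, mem_filter, mem_univ, true_and]
  change (l : ℕ) < i ∧ G.toModel.rep i (G.src l) = b ↔ _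
  rw [rep_eq_self_of_not_conn G horient hC]

/-- … and these lines ARE loops at `v`. [cite: Balaban1983Higgs3, (2.16) p.428] -/
theorem loop_of_mem_before_of_not_conn (horient : ∀ l, G.src l ≠ G.tgt l → G.src l = 0) {i : ℕ}
    (hC : ¬ ∃ l : Fin m, (l : ℕ) < i ∧ G.src l ≠ G.tgt l) {b : Fin 2} {l : Fin m} (hl : l ∈ G.toModel.before i b) :
    G.src l = b ∧ G.tgt l = b := by
  rw [before_of_not_conn G horient hC b, mem_filter] at hl
  have hloop : G.src l = G.tgt l := by
    by_contra hne; exact hC ⟨l, hl.2.1, hne⟩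
  exact ⟨hl.2.2, hloop ▸ hl.2.2⟩

/-- No block of `G₀` is non-trivial (no lines yet). [cite: Balaban1983Higgs3, (2.16) p.428] -/
theorem not_nontriv_zero {V : Type} [Fintype V] [DecidableEq V] {m : ℕ} (G : Counts V m) (b : V) :
    ¬ G.toModel.Nontriv 0 b := by
  simp [Model.Nontriv, Model.before_zero]

/-- **(2.2) in closed form, once `x` and `x′` are joined**: the block of `G_i` has both vertices and the first `i` lines, so
`D(G_i) = (d + e_x) + (d + e_{x′}) − d + Σ_{l<i} a_l`. [cite: Balaban1983Higgs3, (2.2) p.423] -/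
theorem degQ_of_conn (horient : ∀ l, G.src l ≠ G.tgt l → G.src l = 0) {i : ℕ}
    (hC : ∃ l : Fin m, (l : ℕ) < i ∧ G.src l ≠ G.tgt l) :
    degQ G i 0 = (G.d : ℚ) + G.etaPow 0 + G.etaPow 1 + ∑ l ∈ univ.filter (fun l : Fin m => (l : ℕ) < i), lineDimQ G l := by
  unfold degQ
  rw [fiber_of_conn G horient hC, before_of_conn G horient hC, Fin.sum_univ_two]
  ring

/-- **(2.2) in closed form, before that**: the block `{v}` of `G_i` consists of `v` and its loops among the first `i` lines, so
`D = (d + e_v) − d + Σ_{loops l<i at v} a_l`. [cite: Balaban1983Higgs3, (2.2) p.423] -/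
theorem degQ_of_not_conn (horient : ∀ l, G.src l ≠ G.tgt l → G.src l = 0) {i : ℕ}
    (hC : ¬ ∃ l : Fin m, (l : ℕ) < i ∧ G.src l ≠ G.tgt l) (b : Fin 2) :
    degQ G i b = (G.etaPow b : ℚ) + ∑ l ∈ univ.filter (fun l : Fin m => (l : ℕ) < i ∧ G.src l = b), lineDimQ G l := by
  unfold degQ
  rw [fiber_of_not_conn G horient hC b, before_of_not_conn G horient hC b, sum_singleton]
  ring

/-- Every vertex lies on a line, so a two-vertex count datum has at least one line. [cite: Balaban1983Higgs3, Prop. 2.1 p.424] -/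
theorem lines_pos {V : Type} [Fintype V] [DecidableEq V] {m : ℕ} (G : Counts V m) (v : V) : 0 < m := by
  obtain ⟨l, _⟩ := G.touches v
  exact lt_of_le_of_lt (Nat.zero_le _) l.isLt

/-! ## §2 Two vertices: along an arbitrary ordering; the criterion -/

/-- Relabelling the lines along an ordering keeps the shape "each line joins `x` to `x′` or is a loop".
[cite: Balaban1983Higgs3, (2.7) p.425] -/
theorem orient_relabelCounts (horient : ∀ l, G.src l ≠ G.tgt l → G.src l = 0) (σ : Equiv.Perm (Fin m)) :
    ∀ l, (relabelCounts G σ).src l ≠ (relabelCounts G σ).tgt l → (relabelCounts G σ).src l = 0 :=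
  fun l h => horient (σ l) h

/-- The line dimension (2.14) travels with the line under relabelling (definitional). [cite: Balaban1983Higgs3, (2.7) p.425] -/
theorem lineDimQ_relabelCounts {V : Type} [Fintype V] [DecidableEq V] {m : ℕ} (G : Counts V m) (σ : Equiv.Perm (Fin m))
    (l : Fin m) : lineDimQ (relabelCounts G σ) l = lineDimQ G (σ l) := rfl

/-- The total of the line dimensions does not depend on the ordering. [cite: Balaban1983Higgs3, (2.7) p.425] -/
theorem sum_lineDimQ_relabelCounts {V : Type} [Fintype V] [DecidableEq V] {m : ℕ} (G : Counts V m)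
    (σ : Equiv.Perm (Fin m)) : ∑ l, lineDimQ (relabelCounts G σ) l = ∑ l, lineDimQ G l := by
  simp only [lineDimQ_relabelCounts]
  exact Equiv.sum_comp σ (lineDimQ G)

/-- A filtered sum over the relabelled lines is the filtered sum over the original lines (the filter travelling with the line).
[cite: Balaban1983Higgs3, (2.7) p.425] -/
theorem sum_filter_relabel {m : ℕ} (σ : Equiv.Perm (Fin m)) (p : Fin m → Prop) [DecidablePred p] (f : Fin m → ℚ) :
    ∑ l ∈ univ.filter (fun l => p (σ l)), f (σ l) = ∑ l ∈ univ.filter p, f l := by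
  rw [sum_filter, sum_filter]
  exact Equiv.sum_comp σ (fun l => if p l then f l else 0)

/-- A block of some `G_i` along some ordering that contains ALL the lines contains a line joining `x` to `x′` (both vertices lie
on lines, so not all lines are loops at one vertex), hence is the one block `x = 0`. [cite: Balaban1983Higgs3, (2.16) p.428] -/
theorem conn_of_before_eq_univ (horient : ∀ l, G.src l ≠ G.tgt l → G.src l = 0) (σ : Equiv.Perm (Fin m)) {i : ℕ}
    {b : Fin 2} (h : (relabelCounts G σ).toModel.before i b = univ) :
    (∃ l : Fin m, (l : ℕ) < i ∧ (relabelCounts G σ).src l ≠ (relabelCounts G σ).tgt l) ∧ b = 0 := by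
  have horient' := orient_relabelCounts G horient σ
  have hC : ∃ l : Fin m, (l : ℕ) < i ∧ (relabelCounts G σ).src l ≠ (relabelCounts G σ).tgt l := by
    by_contra hC
    -- all lines would be loops at `b`; but the other vertex lies on a line
    have hall : ∀ l : Fin m, (relabelCounts G σ).src l = b ∧ (relabelCounts G σ).tgt l = b := fun l =>
      loop_of_mem_before_of_not_conn (relabelCounts G σ) horient' hC (by rw [h]; exact mem_univ l)
    obtain ⟨l, hl⟩ := (relabelCounts G σ).touches (if b = 0 then 1 else 0)
    obtain ⟨hs, ht⟩ := hall l
    rw [hs, ht, or_self] at hl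
    fin_cases b <;> simp at hl
  refine ⟨hC, ?_⟩
  obtain ⟨l₀, _⟩ := (relabelCounts G σ).touches 0
  have hl₀ : l₀ ∈ (relabelCounts G σ).toModel.before i b := by rw [h]; exact mem_univ _
  rw [(relabelCounts G σ).toModel.mem_before] at hl₀
  have := hl₀.2
  change (relabelCounts G σ).toModel.rep i ((relabelCounts G σ).src l₀) = b at this
  rw [rep_eq_zero_of_conn (relabelCounts G σ) horient' hC] at this
  exact this.symm

/-- **The degree of the WHOLE graph does not depend on the ordering**: a block of `G_i` (along `σ`) containing all the lines is
both vertices with all lines, `D(G) = d + e_x + e_{x′} + Σ_l a_l`. [cite: Balaban1983Higgs3, (2.2) p.423] -/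
theorem degQ_relabel_of_before_eq_univ (horient : ∀ l, G.src l ≠ G.tgt l → G.src l = 0) (σ : Equiv.Perm (Fin m)) {i : ℕ}
    {b : Fin 2} (h : (relabelCounts G σ).toModel.before i b = univ) :
    degQ (relabelCounts G σ) i b = (G.d : ℚ) + G.etaPow 0 + G.etaPow 1 + ∑ l, lineDimQ G l := by
  obtain ⟨hC, rfl⟩ := conn_of_before_eq_univ G horient σ h
  have horient' := orient_relabelCounts G horient σ
  rw [degQ_of_conn (relabelCounts G σ) horient' hC, ← before_of_conn (relabelCounts G σ) horient' hC, h,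
    sum_lineDimQ_relabelCounts]
  rfl

/-- **THE CRITERION, proper subgraphs** — p. 435 *"primitively divergent graphs (graphs whose every proper subgraph is
convergent)"* for the one- or two-vertex pictures: if every line dimension is negative (`hneg`), the whole graph has degree
`W = d + e_x + e_{x′} + Σ_l a_l ≥ 0` (`hW`; `= 0` for the pictures of (3.18)), and each vertex carrying loops keeps a positive
degree with all its loops (`hloop`), then along EVERY ordering every non-trivial block NOT containing all the lines has POSITIVE
degree: a block reached after joining `x` to `x′` misses a nonempty set `S` of lines and has degree `W − Σ_{l∈S} a_l > 0`; a block
`{v}` of loops has degree `≥ e_v + Σ_{all loops at v} a_l > 0`.  (Literally the hypothesis `hprop` of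
`B3Eq320PositiveSubgraphs.posSubgraphsExcept24_of_degZero`.) [cite: Balaban1983Higgs3, (3.18) p.438] -/
theorem properPos_of_twoVertex (horient : ∀ l, G.src l ≠ G.tgt l → G.src l = 0) (hneg : ∀ l, lineDimQ G l < 0)
    (hW : 0 ≤ (G.d : ℚ) + G.etaPow 0 + G.etaPow 1 + ∑ l, lineDimQ G l)
    (hloop : ∀ v : Fin 2, (∃ l, G.src l = v ∧ G.tgt l = v) →
      0 < (G.etaPow v : ℚ) + ∑ l ∈ univ.filter (fun l : Fin m => G.src l = v ∧ G.tgt l = v), lineDimQ G l)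
    (σ : Equiv.Perm (Fin m)) (i : ℕ) (b : Fin 2) (hb : b ∈ (relabelCounts G σ).toModel.reps i)
    (hn : (relabelCounts G σ).toModel.Nontriv i b) (hne : (relabelCounts G σ).toModel.before i b ≠ univ) :
    0 < degQ (relabelCounts G σ) i b := by
  set G' := relabelCounts G σ with hG'
  have horient' : ∀ l, G'.src l ≠ G'.tgt l → G'.src l = 0 := orient_relabelCounts G horient σ
  have hneg' : ∀ l, lineDimQ G' l < 0 := fun l => by rw [hG', lineDimQ_relabelCounts]; exact hneg (σ l)
  by_cases hC : ∃ l : Fin m, (l : ℕ) < i ∧ G'.src l ≠ G'.tgt l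
  · -- one block with the first `i` lines; the missing lines have negative dimensions
    have hb0 : b = 0 := eq_zero_of_mem_reps_of_conn G' horient' hC hb
    subst hb0
    rw [degQ_of_conn G' horient' hC]
    set S := univ.filter (fun l : Fin m => (l : ℕ) < i) with hS
    have hSne : S ≠ univ := by rw [hS, ← before_of_conn G' horient' hC]; exact hne
    have hsplit : ∑ l ∈ S, lineDimQ G' l + ∑ l ∈ univ \ S, lineDimQ G' l = ∑ l, lineDimQ G l := by
      rw [add_comm, sum_sdiff (subset_univ S), hG', sum_lineDimQ_relabelCounts]
    have hcne : (univ \ S).Nonempty := by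
      rw [sdiff_nonempty]; exact fun h => hSne (subset_antisymm (subset_univ S) h)
    have hcneg : ∑ l ∈ univ \ S, lineDimQ G' l < 0 := sum_neg (fun l _ => hneg' l) hcne
    have hd : (G'.d : ℚ) = G.d := rfl
    have he : ∀ v, (G'.etaPow v : ℚ) = G.etaPow v := fun v => rfl
    rw [hd, he, he]
    linarith
  · -- a block `{b}` made of loops at `b`
    obtain ⟨l₀, hl₀⟩ := hn
    have hloop₀ := loop_of_mem_before_of_not_conn G' horient' hC hl₀
    rw [degQ_of_not_conn G' horient' hC b]
    set S := univ.filter (fun l : Fin m => (l : ℕ) < i ∧ G'.src l = b) with hS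
    set T := univ.filter (fun l : Fin m => G'.src l = b ∧ G'.tgt l = b) with hT
    have hST : S ⊆ T := by
      intro l hl
      have hl' : l ∈ G'.toModel.before i b := by rw [before_of_not_conn G' horient' hC b]; exact hl
      have := loop_of_mem_before_of_not_conn G' horient' hC hl'
      rw [hT, mem_filter]; exact ⟨mem_univ _, this⟩
    have hle : ∑ l ∈ T, lineDimQ G' l ≤ ∑ l ∈ S, lineDimQ G' l := by
      rw [← sum_sdiff hST]
      have : ∑ l ∈ T \ S, lineDimQ G' l ≤ 0 := sum_nonpos fun l _ => (hneg' l).le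
      linarith
    -- the loops of `G'` at `b` are the relabelled loops of `G` at `b`
    have hT' : ∑ l ∈ T, lineDimQ G' l = ∑ l ∈ univ.filter (fun l : Fin m => G.src l = b ∧ G.tgt l = b), lineDimQ G l := by
      rw [hT]
      exact sum_filter_relabel σ (fun l => G.src l = b ∧ G.tgt l = b) (lineDimQ G)
    have hpos := hloop b ⟨σ l₀, hloop₀⟩
    have he : (G'.etaPow b : ℚ) = G.etaPow b := rfl
    rw [he]
    linarith

/-- **THE CRITERION, the whole graph** — p. 438 *"All the remaining divergent graphs of this type have degrees equal to 0"*: if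
`W = d + e_x + e_{x′} + Σ_l a_l = 0` then along every ordering every block containing all the lines has degree `0`.  (Literally
the hypothesis `hzero` of `B3Eq320PositiveSubgraphs.posSubgraphsExcept24_of_degZero`.) [cite: Balaban1983Higgs3, (3.18) p.438] -/
theorem degZero_of_twoVertex (horient : ∀ l, G.src l ≠ G.tgt l → G.src l = 0)
    (hW : (G.d : ℚ) + G.etaPow 0 + G.etaPow 1 + ∑ l, lineDimQ G l = 0) (σ : Equiv.Perm (Fin m)) (i : ℕ) (b : Fin 2)
    (h : (relabelCounts G σ).toModel.before i b = univ) : degQ (relabelCounts G σ) i b = 0 := by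
  rw [degQ_relabel_of_before_eq_univ G horient σ h, hW]

/-- The same with extra line dimensions `κ` of total `Σκ`: a block containing all the lines has generalized degree `W + Σκ`,
positive as soon as `0 < W + Σκ`.  (The hypothesis `hwhole` of `B3Eq320PositiveSubgraphs.posSubgraphsExcept24_of_properPos`.)
[cite: Balaban1983Higgs3, (3.20) p.438] -/
theorem wholePos_of_twoVertex (horient : ∀ l, G.src l ≠ G.tgt l → G.src l = 0) (κ : Fin m → ℚ)
    (hW : 0 < (G.d : ℚ) + G.etaPow 0 + G.etaPow 1 + ∑ l, lineDimQ G l + ∑ l, κ l) (σ : Equiv.Perm (Fin m)) (i : ℕ)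
    (b : Fin 2) (h : (relabelCounts G σ).toModel.before i b = univ) : 0 < degQ (relabelCounts G σ) i b + ∑ l, κ l := by
  rw [degQ_relabel_of_before_eq_univ G horient σ h]; exact hW

end TwoVertex

/-! ## §3 One vertex: all lines are loops (the second picture of (3.18)) -/

section OneVertex

variable {m : ℕ} (G : Counts (Fin 1) m)

/-- With one vertex every block map is the identity (= the constant `0`). [cite: Balaban1983Higgs3, (2.16) p.428] -/
theorem rep_oneVertex (i : ℕ) (v : Fin 1) : G.toModel.rep i v = 0 := Subsingleton.elim _ _

/-- The block of `G_i`: the vertex. [cite: Balaban1983Higgs3, (2.16) p.428] -/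
theorem fiber_oneVertex (i : ℕ) : G.toModel.fiber i 0 = univ := by
  ext v; simp only [G.toModel.mem_fiber, rep_oneVertex, mem_univ]

/-- Its lines: the first `i` lines of the ordering (all loops). [cite: Balaban1983Higgs3, (2.16) p.428] -/
theorem before_oneVertex (i : ℕ) (b : Fin 1) : G.toModel.before i b = univ.filter fun l : Fin m => (l : ℕ) < i := by
  ext l
  simp only [G.toModel.mem_before, mem_filter, mem_univ, true_and, Subsingleton.elim (G.toModel.rep i _) b, and_true]

/-- **(2.2) in closed form**: `D(G_i) = (d + e_x) − d + Σ_{l<i} a_l = e_x + Σ_{l<i} a_l`. [cite: Balaban1983Higgs3, (2.2) p.423] -/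
theorem degQ_oneVertex (i : ℕ) (b : Fin 1) :
    degQ G i b = (G.etaPow 0 : ℚ) + ∑ l ∈ univ.filter (fun l : Fin m => (l : ℕ) < i), lineDimQ G l := by
  have hb : b = 0 := Subsingleton.elim _ _
  subst hb
  unfold degQ
  rw [fiber_oneVertex, before_oneVertex]
  simp only [univ_unique, Fin.default_eq_zero, sum_singleton]
  ring

/-- **The degree of the whole one-vertex graph** along any ordering: `e_x + Σ_l a_l`. [cite: Balaban1983Higgs3, (2.2) p.423] -/
theorem degQ_relabel_of_before_eq_univ_oneVertex (σ : Equiv.Perm (Fin m)) {i : ℕ} {b : Fin 1}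
    (h : (relabelCounts G σ).toModel.before i b = univ) :
    degQ (relabelCounts G σ) i b = (G.etaPow 0 : ℚ) + ∑ l, lineDimQ G l := by
  rw [degQ_oneVertex, ← before_oneVertex, h, sum_lineDimQ_relabelCounts]
  rfl

/-- **THE CRITERION, proper subgraphs, one vertex**: negative line dimensions and `0 ≤ W = e_x + Σ_l a_l` give every proper
non-trivial block along every ordering a positive degree `W − Σ_{missing} a_l`. [cite: Balaban1983Higgs3, (3.18) p.438] -/
theorem properPos_of_oneVertex (hneg : ∀ l, lineDimQ G l < 0) (hW : 0 ≤ (G.etaPow 0 : ℚ) + ∑ l, lineDimQ G l)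
    (σ : Equiv.Perm (Fin m)) (i : ℕ) (b : Fin 1) (_hb : b ∈ (relabelCounts G σ).toModel.reps i)
    (_hn : (relabelCounts G σ).toModel.Nontriv i b) (hne : (relabelCounts G σ).toModel.before i b ≠ univ) :
    0 < degQ (relabelCounts G σ) i b := by
  set G' := relabelCounts G σ with hG'
  have hneg' : ∀ l, lineDimQ G' l < 0 := fun l => by rw [hG', lineDimQ_relabelCounts]; exact hneg (σ l)
  rw [degQ_oneVertex G' i b]
  set S := univ.filter (fun l : Fin m => (l : ℕ) < i) with hS
  have hSne : S ≠ univ := by rw [hS, ← before_oneVertex G' i b]; exact hne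
  have hsplit : ∑ l ∈ S, lineDimQ G' l + ∑ l ∈ univ \ S, lineDimQ G' l = ∑ l, lineDimQ G l := by
    rw [add_comm, sum_sdiff (subset_univ S), hG', sum_lineDimQ_relabelCounts]
  have hcne : (univ \ S).Nonempty := by
    rw [sdiff_nonempty]; exact fun h => hSne (subset_antisymm (subset_univ S) h)
  have hcneg : ∑ l ∈ univ \ S, lineDimQ G' l < 0 := sum_neg (fun l _ => hneg' l) hcne
  have he : (G'.etaPow 0 : ℚ) = G.etaPow 0 := rfl
  rw [he]
  linarith

/-- **THE CRITERION, the whole graph, one vertex**: `W = e_x + Σ_l a_l = 0` ⇒ every block containing all the lines has degree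
`0`. [cite: Balaban1983Higgs3, (3.18) p.438] -/
theorem degZero_of_oneVertex (hW : (G.etaPow 0 : ℚ) + ∑ l, lineDimQ G l = 0) (σ : Equiv.Perm (Fin m)) (i : ℕ)
    (b : Fin 1) (h : (relabelCounts G σ).toModel.before i b = univ) : degQ (relabelCounts G σ) i b = 0 := by
  rw [degQ_relabel_of_before_eq_univ_oneVertex G σ h, hW]

end OneVertex

/-! ## §4 Connectivity -/

/-- A two-vertex count datum with a line from `x` to `x′` is connected (*"Let G be a connected graph"*, Prop. 2.1 p. 424).
[cite: Balaban1983Higgs3, Prop. 2.1 p.424] -/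
theorem linesConnect_twoVertex {m : ℕ} (G : Counts (Fin 2) m) (h : ∃ l, G.src l = 0 ∧ G.tgt l = 1) :
    LinesConnect G.src G.tgt := by
  obtain ⟨l, hs, ht⟩ := h
  have h01 : Relation.EqvGen (fun a b : Fin 2 => ∃ l, G.src l = a ∧ G.tgt l = b) 0 1 :=
    Relation.EqvGen.rel _ _ ⟨l, hs, ht⟩
  intro u w
  fin_cases u <;> fin_cases w
  · exact Relation.EqvGen.refl _
  · exact h01
  · exact h01.symm
  · exact Relation.EqvGen.refl _

/-- A one-vertex count datum is connected. [cite: Balaban1983Higgs3, Prop. 2.1 p.424] -/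
theorem linesConnect_oneVertex {m : ℕ} (G : Counts (Fin 1) m) : LinesConnect G.src G.tgt := by
  intro u w
  rw [Subsingleton.elim u w]
  exact Relation.EqvGen.refl _

end Literature.MathematicalPhysics.QuantumFieldTheory.Balaban1983to89.B3TwoVertexBlocks
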